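import Summits.CriticalPhenomena.PercolationContinuityZ3.Theorems.PercNearOneGluingNoHeavyLowerTailSahiGridPatternCoTop
import Summits.CriticalPhenomena.PercolationContinuityZ3.Theorems.PercNearOneGluingNoHeavyLowerTailSahiGridPatternCoMid
import Summits.CriticalPhenomena.PercolationContinuityZ3.Theorems.PercNearOneGluingNoHeavyLowerTailSahiGridPatternMidTop

/-!
# `NoHeavyLowerTail` (crux stmt-CriticalPhenomena-4575), Sahi programme: **THE PATTERN INEQUALITY WITH ONE CO-ORTHANT SLOT,
# EVERY DIMENSION** — `sStarD {x : x ≰ q} B C ≥ 0` for the complement of every principal down-set and arbitrary up-sets `B, C`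

Support file (seat `prim-sahi-p1`, generation 9; `--supports stmt-CriticalPhenomena-4575`).  Pure proofs, no definitions, no `sorry`,
standard axioms.  Dual companion of `…SahiGridPatternOrthant` (one ORTHANT slot); uses the co-top lift `(D,⊤,⊤)`
(`sStarD_nonneg_of_coTop`) and the co-mid lift `(D,D,⊤)` (`sum_sStarD_le_of_coMid`).

* `sStarD_coprincipal_nonneg` (every `d`): for every `q ∈ [3]^d` and all up-sets `B, C ⊆ [3]^d`,
  `0 ≤ sStarD {x : ∃ a, q_a < x_a} B C` — the first slot is the complement `[3]^d ∖ ↓q` of a principal down-set (a 'co-orthant':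
  `x_a > q_a` for SOME axis; coordinates with `q_a = 2` are free).  Proof: induction on `d`; move an axis with `q_a ≤ 1` to the last
  position (`slicePos_perm`); the slices of the co-orthant along it are `(A′,⊤,⊤)` (`q_a = 0`: co-top lift, unconditional) or `(A′,A′,⊤)`
  (`q_a = 1`: co-mid lift + induction); if every `q_a = 2` the set is empty.  Likewise in the other two slots (`sStarD_swap12/23`).
* `latticeE3_gridProd_nonneg_coorthant`, `sahiE_three_coorthant_nonneg` (every grid `[K+1]^d`, every product weight): Sahi's third-order
  functional `Z³E₃(1_A,1_B,1_C) ≥ 0` (resp. `E₃ ≥ 0` for a probability weight) when `A = {x : ∃ a, q_a < x_a}` is the complement of a box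
  `{x ≤ q}` and `B, C` are arbitrary up-sets — Sahi's `C₃` / Kahn's Conjecture 5 at `n = 3` with one 'OR of thresholds' slot, coefficientwise,
  every dimension (the orthant = 'AND of thresholds' slot is `latticeE3_gridProd_nonneg_orthant`). [this work]
-/

namespace Summit.CriticalPhenomena.PercolationContinuityZ3.Theorems.SahiGridPattern

open Finset Literature.Probability.LatticeModels Literature.Combinatorics.Sahi2008
open SahiGrid3 (ind)
open scoped BigOperators

variable {n : ℕ}

/-! ### The co-orthant slot on `[3]^d` -/

/-- Slices of a co-orthant along the last axis: `snoc x l ≰ q` iff `x ≰ init q` or `l > q last`. [this work] -/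
theorem exists_lt_snoc_iff (q : Pd (n + 1)) (x : Pd n) (l : Fin 3) :
    (∃ a, q a < (Fin.snoc x l : Pd (n + 1)) a) ↔ ((∃ b : Fin n, q (Fin.castSucc b) < x b) ∨ q (Fin.last n) < l) := by
  constructor
  · rintro ⟨a, ha⟩
    revert ha
    refine Fin.lastCases ?_ (fun b => ?_) a
    · intro h; right; simpa [Fin.snoc_last] using h
    · intro h; left; exact ⟨b, by simpa [Fin.snoc_castSucc] using h⟩
  · rintro (⟨b, hb⟩ | h)
    · exact ⟨Fin.castSucc b, by simpa [Fin.snoc_castSucc] using hb⟩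
    · exact ⟨Fin.last n, by simpa [Fin.snoc_last] using h⟩

/-- A co-orthant `{x : ∃ a, q_a < x_a}` of `[3]^d` is an up-set. [this work] -/
theorem isUpperSet_filter_exists_lt {d : ℕ} (q : Pd d) :
    IsUpperSet ((univ.filter fun x : Pd d => ∃ a, q a < x a : Finset (Pd d)) : Set (Pd d)) := by
  intro x y hxy hx
  rw [Finset.mem_coe, Finset.mem_filter] at hx ⊢
  obtain ⟨a, ha⟩ := hx.2
  exact ⟨Finset.mem_univ _, a, lt_of_lt_of_le ha (hxy a)⟩

/-- The inductive step: a co-orthant whose LAST threshold is `≤ 1`, given the theorem one dimension down. [this work] -/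
theorem sStarD_filter_exists_lt_nonneg_step
    (ih : ∀ (q' : Pd n) (B C : Finset (Pd n)), IsUpperSet (B : Set (Pd n)) → IsUpperSet (C : Set (Pd n)) →
      0 ≤ sStarD (univ.filter fun x : Pd n => ∃ b, q' b < x b) B C)
    (q : Pd (n + 1)) (hq : q (Fin.last n) ≠ 2) (B C : Finset (Pd (n + 1)))
    (hB : IsUpperSet (B : Set (Pd (n + 1)))) (hC : IsUpperSet (C : Set (Pd (n + 1)))) :
    0 ≤ sStarD (univ.filter fun x : Pd (n + 1) => ∃ a, q a < x a) B C := by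
  set A : Finset (Pd (n + 1)) := univ.filter fun x : Pd (n + 1) => ∃ a, q a < x a with hAdef
  have hA : IsUpperSet (A : Set (Pd (n + 1))) := by rw [hAdef]; exact isUpperSet_filter_exists_lt q
  set q' : Pd n := fun b => q (Fin.castSucc b) with hq'def
  have memA : ∀ (x : Pd n) (l : Fin 3), (Fin.snoc x l : Pd (n + 1)) ∈ A ↔ ((∃ b, q' b < x b) ∨ q (Fin.last n) < l) := by
    intro x l; rw [hAdef, Finset.mem_filter, exists_lt_snoc_iff]; simp [hq'def]
  have hcases : q (Fin.last n) = 0 ∨ q (Fin.last n) = 1 := by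
    have key : ∀ i : Fin 3, i ≠ 2 → i = 0 ∨ i = 1 := by decide
    exact key _ hq
  rcases hcases with h0 | h1
  · -- co-top lift: slices (A', ⊤, ⊤); unconditional
    have hA1 : ∀ x : Pd n, (Fin.snoc x 1 : Pd (n + 1)) ∈ A := by
      intro x; rw [memA, h0]; right; decide
    exact sStarD_nonneg_of_coTop A B C hA hB hC hA1
  · -- co-mid lift: slices (A', A', ⊤)
    have hA01 : ∀ x : Pd n, (Fin.snoc x 0 : Pd (n + 1)) ∈ A ↔ (Fin.snoc x 1 : Pd (n + 1)) ∈ A := by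
      intro x; rw [memA, memA, h1]
      have e0 : ¬ ((1:Fin 3) < 0) := by decide
      have e1 : ¬ ((1:Fin 3) < 1) := by decide
      simp only [e0, e1, or_false]
    have hA2 : ∀ x : Pd n, (Fin.snoc x 2 : Pd (n + 1)) ∈ A := by
      intro x; rw [memA, h1]; right; decide
    have L := sum_sStarD_le_of_coMid A B C hA hB hC hA01 hA2
    have midA : (univ.filter fun x : Pd n => (Fin.snoc x 1 : Pd (n + 1)) ∈ A) = univ.filter fun x : Pd n => ∃ b, q' b < x b := by
      ext x; simp only [Finset.mem_filter, Finset.mem_univ, true_and, memA, h1]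
      have e1 : ¬ ((1:Fin 3) < 1) := by decide
      simp only [e1, or_false]
    rw [midA] at L
    have i01 := ih q' _ _ (isUpperSet_filter_snoc hB 0) (isUpperSet_filter_snoc hC 1)
    have i10 := ih q' _ _ (isUpperSet_filter_snoc hB 1) (isUpperSet_filter_snoc hC 0)
    linarith

/-- **THE PATTERN INEQUALITY WITH ONE CO-ORTHANT SLOT, EVERY DIMENSION**: for every `d`, every `q ∈ [3]^d` and all up-sets
`B, C ⊆ [3]^d`, `0 ≤ sStarD {x : ∃ a, q_a < x_a} B C` — the first slot is the complement of the principal down-set `↓q`. [this work] -/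
theorem sStarD_coprincipal_nonneg : ∀ (d : ℕ) (q : Pd d) (B C : Finset (Pd d)),
    IsUpperSet (B : Set (Pd d)) → IsUpperSet (C : Set (Pd d)) → 0 ≤ sStarD (univ.filter fun x : Pd d => ∃ a, q a < x a) B C := by
  intro d
  induction d with
  | zero =>
    intro q B C hB hC
    have e : (univ.filter fun x : Pd 0 => ∃ a, q a < x a) = ∅ := by
      ext x; simp only [Finset.mem_filter, Finset.mem_univ, true_and, Finset.notMem_empty, iff_false, not_exists]
      exact fun a => Fin.elim0 a
    rw [e, sStarD_empty_left]
  | succ n ih =>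
    intro q B C hB hC
    by_cases hz : ∃ a, q a ≠ 2
    · obtain ⟨a, ha⟩ := hz
      let τ : Equiv.Perm (Fin (n + 1)) := Equiv.swap a (Fin.last n)
      have hq : (q ∘ τ) (Fin.last n) ≠ 2 := by
        show q (τ (Fin.last n)) ≠ 2
        rw [Equiv.swap_apply_right]; exact ha
      have step : ∀ B' C' : Finset (Pd (n + 1)), IsUpperSet (B' : Set (Pd (n + 1))) → IsUpperSet (C' : Set (Pd (n + 1))) →
          0 ≤ ∑ x ∈ (univ.filter fun x : Pd (n + 1) => ∃ b, (q ∘ τ) b < x b), ∑ y ∈ B', ∑ z ∈ C', tcD x y z := by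
        intro B' C' hB' hC'
        rw [← sStarD_eq_sum_tcD]
        exact sStarD_filter_exists_lt_nonneg_step ih (q ∘ τ) hq B' C' hB' hC'
      have hmem : ∀ x : Pd (n + 1), x ∈ (univ.filter fun x : Pd (n + 1) => ∃ b, q b < x b) ↔
          x ∘ τ ∈ (univ.filter fun x : Pd (n + 1) => ∃ b, (q ∘ τ) b < x b) := by
        intro x
        simp only [Finset.mem_filter, Finset.mem_univ, true_and, Function.comp_apply]
        constructor
        · rintro ⟨b, hb⟩; exact ⟨τ.symm b, by simpa using hb⟩
        · rintro ⟨b, hb⟩; exact ⟨τ b, hb⟩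
      rw [sStarD_eq_sum_tcD]
      exact slicePos_perm τ step hmem B C hB hC
    · simp only [not_exists, not_not] at hz
      have e : (univ.filter fun x : Pd (n + 1) => ∃ a, q a < x a) = ∅ := by
        ext x; simp only [Finset.mem_filter, Finset.mem_univ, true_and, Finset.notMem_empty, iff_false, not_exists]
        intro a; rw [hz a]; exact (by decide : ∀ i : Fin 3, ¬ ((2:Fin 3) < i)) _
      rw [e, sStarD_empty_left]

/-- Co-orthant in the second slot. [this work] -/
theorem sStarD_coprincipal_nonneg₂ {d : ℕ} (q : Pd d) {A C : Finset (Pd d)}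
    (hA : IsUpperSet (A : Set (Pd d))) (hC : IsUpperSet (C : Set (Pd d))) :
    0 ≤ sStarD A (univ.filter fun x : Pd d => ∃ a, q a < x a) C := by
  rw [sStarD_swap12]; exact sStarD_coprincipal_nonneg d q A C hA hC

/-- Co-orthant in the third slot. [this work] -/
theorem sStarD_coprincipal_nonneg₃ {d : ℕ} (q : Pd d) {A B : Finset (Pd d)}
    (hA : IsUpperSet (A : Set (Pd d))) (hB : IsUpperSet (B : Set (Pd d))) :
    0 ≤ sStarD A B (univ.filter fun x : Pd d => ∃ a, q a < x a) := by
  rw [sStarD_swap23, sStarD_swap12]; exact sStarD_coprincipal_nonneg d q A B hA hB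

/-! ### Grid form -/

variable {d K : ℕ}

/-- Strict thresholds: for a monotone triple `v₀ ≤ v₁ ≤ v₂`, the set `{c : x < v_c}` is `[3]`, empty, or `{c : t < c}` for some `t`.
[this work] -/
theorem threshold_three_lt {α : Type*} [Preorder α] (v : Fin 3 → α) (hv : Monotone v) (x : α) (h0 : ¬ x < v 0) :
    ∃ t : Fin 3, ∀ c : Fin 3, (x < v c ↔ t < c) := by
  by_cases h1 : x < v 1
  · refine ⟨0, fun c => ?_⟩
    fin_cases c
    · exact iff_of_false h0 (by decide)
    · exact iff_of_true h1 (by decide)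
    · exact iff_of_true (lt_of_lt_of_le h1 (hv (by decide))) (by decide)
  by_cases h2 : x < v 2
  · refine ⟨1, fun c => ?_⟩
    fin_cases c
    · exact iff_of_false h0 (by decide)
    · exact iff_of_false h1 (by decide)
    · exact iff_of_true h2 (by decide)
  · refine ⟨2, fun c => ?_⟩
    fin_cases c
    · exact iff_of_false h0 (by decide)
    · exact iff_of_false h1 (by decide)
    · exact iff_of_false h2 (by decide)

/-- **The symmetrised pattern value of (co-orthant, up-set, up-set) is nonnegative** at every three-point sample `ω` of the grid: after
sorting, the co-orthant pulls back to the whole cube or to a co-orthant of `[3]^d`. [this work] -/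
theorem Ssym_nonneg_coorthant (q : Xd d K) {B C : Finset (Xd d K)} (hB : IsUpperSet (B : Set (Xd d K)))
    (hC : IsUpperSet (C : Set (Xd d K))) (ω : Fin 3 → Xd d K) :
    0 ≤ Ssym (univ.filter fun x : Xd d K => ∃ a, q a < x a) B C ω := by
  set A : Finset (Xd d K) := univ.filter fun x : Xd d K => ∃ a, q a < x a with hAdef
  let σ : Fin d → Equiv.Perm (Fin 3) := fun a => Tuple.sort fun c => ω c a
  have hsort : ∀ a, Monotone fun c => Tmap σ ω c a := fun a => by
    show Monotone ((fun c => ω c a) ∘ σ a)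
    exact Tuple.monotone_sort _
  rw [← S_Tmap A B C σ ω, S_eq_sStarD]
  set ω' : Fin 3 → Xd d K := Tmap σ ω with hω'
  have mem_pb : ∀ p : Pd d, p ∈ pb ω' A ↔ ∃ a, q a < ω' (p a) a := by
    intro p; unfold pb; rw [Finset.mem_filter, hAdef, Finset.mem_filter]; simp
  by_cases hbot : ∃ a, q a < ω' 0 a
  · -- some axis is exceeded already at the bottom level: the pull-back is the whole cube
    obtain ⟨a, ha⟩ := hbot
    have e : pb ω' A = univ := by
      ext p; rw [mem_pb]; simp only [Finset.mem_univ, iff_true]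
      exact ⟨a, lt_of_lt_of_le ha (hsort a (Fin.zero_le _))⟩
    rw [e]; exact sStarD_nonneg_of_eq_univ₁ (isUpperSet_pb hsort hB) (isUpperSet_pb hsort hC)
  · simp only [not_exists] at hbot
    choose t ht using fun a => threshold_three_lt (fun c => ω' c a) (hsort a) (q a) (hbot a)
    have e : pb ω' A = univ.filter fun p : Pd d => ∃ a, t a < p a := by
      ext p; rw [mem_pb, Finset.mem_filter]
      simp only [Finset.mem_univ, true_and]
      exact ⟨fun ⟨a, h⟩ => ⟨a, (ht a (p a)).1 h⟩, fun ⟨a, h⟩ => ⟨a, (ht a (p a)).2 h⟩⟩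
    rw [e]
    exact sStarD_coprincipal_nonneg d t _ _ (isUpperSet_pb hsort hB) (isUpperSet_pb hsort hC)

/-- **SAHI'S `C₃` WITH ONE CO-ORTHANT SLOT ON EVERY GRID, homogeneous form** (every `d`, `K`): for every nonnegative product weight
on `[K+1]^d`, every `q` and all up-sets `B, C`, `0 ≤ latticeE3 w {x : ∃ a, q_a < x_a} B C` (`= Z³E₃(1_A,1_B,1_C)`, `A` the complement of
the box `{x ≤ q}`). [this work] -/
theorem latticeE3_gridProd_nonneg_coorthant (g : Fin d → Fin (K + 1) → ℝ) (hg : ∀ a u, 0 ≤ g a u) (q : Xd d K)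
    {B C : Finset (Xd d K)} (hB : IsUpperSet (B : Set (Xd d K))) (hC : IsUpperSet (C : Set (Xd d K))) :
    0 ≤ latticeE3 (fun ω : Xd d K => ∏ a, g a (ω a)) (univ.filter fun x : Xd d K => ∃ a, q a < x a) B C := by
  have hcard : (0 : ℝ) < Fintype.card (Fin d → Equiv.Perm (Fin 3)) := by exact_mod_cast Fintype.card_pos
  have h := latticeE3_symm g (univ.filter fun x : Xd d K => ∃ a, q a < x a) B C
  have hsum : 0 ≤ ∑ ω : Fin 3 → Xd d K, (∏ c, ∏ a, g a (ω c a)) *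
      (Ssym (univ.filter fun x : Xd d K => ∃ a, q a < x a) B C ω : ℝ) :=
    Finset.sum_nonneg fun ω _ => mul_nonneg (Finset.prod_nonneg fun c _ => Finset.prod_nonneg fun a _ => hg a _)
      (by exact_mod_cast Ssym_nonneg_coorthant q hB hC ω)
  rw [← h] at hsum
  exact (mul_nonneg_iff_of_pos_left hcard).1 hsum

/-- **SAHI'S `C₃` WITH ONE CO-ORTHANT SLOT ON EVERY GRID, probability form**: for every product probability weight `w = ⊗ g_i` on
`[K+1]^d`, every `q` and all up-sets `B, C`, `0 ≤ E₃(1_A, 1_B, 1_C)` with `A = {x : ∃ a, q_a < x_a}`. [this work] -/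
theorem sahiE_three_coorthant_nonneg (g : Fin d → Fin (K + 1) → ℝ) (hg0 : ∀ i u, 0 ≤ g i u) (hg1 : ∀ i, ∑ u, g i u = 1)
    (q : Xd d K) {B C : Finset (Xd d K)} (hB : IsUpperSet (B : Set (Xd d K))) (hC : IsUpperSet (C : Set (Xd d K))) :
    0 ≤ sahiE (fun ω : Xd d K => ∏ i, g i (ω i)) 3
      ![setInd (univ.filter fun x : Xd d K => ∃ a, q a < x a), setInd B, setInd C] := by
  classical
  have hsum : ∑ ω : Fin d → Fin (K + 1), ∏ i, g i (ω i) = 1 := by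
    rw [← Fintype.prod_sum]; simp [hg1]
  rw [sahiE_three_indicator_eq_latticeE3 hsum]
  exact latticeE3_gridProd_nonneg_coorthant g hg0 q hB hC

/-! ### Closure of the good first slots under the co-lifts -/

/-- **Co-mid lift of a good slot** (every `n`): if `D ⊆ [3]^n` satisfies `sStarD D U V ≥ 0` for all up-sets `U, V`, then so does every
up-set `A ⊆ [3]^{n+1}` with slice pattern `(D,D,⊤)` along the last axis. [this work] -/
theorem sStarD_nonneg_coMid_of_good {D : Finset (Pd n)}
    (hD : ∀ U V : Finset (Pd n), IsUpperSet (U : Set (Pd n)) → IsUpperSet (V : Set (Pd n)) → 0 ≤ sStarD D U V)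
    (A B C : Finset (Pd (n + 1))) (hA : IsUpperSet (A : Set (Pd (n + 1)))) (hB : IsUpperSet (B : Set (Pd (n + 1))))
    (hC : IsUpperSet (C : Set (Pd (n + 1)))) (hA0 : ∀ q : Pd n, (Fin.snoc q 0 : Pd (n + 1)) ∈ A ↔ q ∈ D)
    (hA1 : ∀ q : Pd n, (Fin.snoc q 1 : Pd (n + 1)) ∈ A ↔ q ∈ D) (hA2 : ∀ q : Pd n, (Fin.snoc q 2 : Pd (n + 1)) ∈ A) :
    0 ≤ sStarD A B C := by
  have hA01 : ∀ q : Pd n, (Fin.snoc q 0 : Pd (n + 1)) ∈ A ↔ (Fin.snoc q 1 : Pd (n + 1)) ∈ A := fun q => by rw [hA0, hA1]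
  have L := sum_sStarD_le_of_coMid A B C hA hB hC hA01 hA2
  have e : (univ.filter fun q : Pd n => (Fin.snoc q 1 : Pd (n + 1)) ∈ A) = D := by ext q; simp [hA1]
  rw [e] at L
  have h01 := hD _ _ (isUpperSet_filter_snoc hB 0) (isUpperSet_filter_snoc hC 1)
  have h10 := hD _ _ (isUpperSet_filter_snoc hB 1) (isUpperSet_filter_snoc hC 0)
  linarith

/-- **Mid-top lift of a good slot** (every `n`): if `D ⊆ [3]^n` satisfies `sStarD D U V ≥ 0` for all up-sets `U, V`, then so does every
up-set `A ⊆ [3]^{n+1}` with slice pattern `(∅,D,⊤)` along the last axis.  (The co-top pattern `(D,⊤,⊤)` needs no hypothesis on `D`: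
`sStarD_nonneg_of_coTop`.)  With `sStarD_nonneg_liftTop_of_good`, `sStarD_nonneg_liftTwo_of_good` and these, every monotone slice pattern
over `{∅, D, ⊤}` except the cylinder `(D,D,D)` preserves good first slots; iterating along the axes (free coordinates innermost) gives the
pattern inequality for every NESTED-CANALYSING first slot — an up-set readable as a decision list 'x_{a₁} ≥ s₁ ⇒ in; x_{a₁} < t₁ ⇒ out; else
recurse' — of which orthants (`sStarD_principal_nonneg`) and co-orthants (`sStarD_coprincipal_nonneg`) are the pure cases. [this work] -/
theorem sStarD_nonneg_midTop_of_good {D : Finset (Pd n)}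
    (hD : ∀ U V : Finset (Pd n), IsUpperSet (U : Set (Pd n)) → IsUpperSet (V : Set (Pd n)) → 0 ≤ sStarD D U V)
    (A B C : Finset (Pd (n + 1))) (hA : IsUpperSet (A : Set (Pd (n + 1)))) (hB : IsUpperSet (B : Set (Pd (n + 1))))
    (hC : IsUpperSet (C : Set (Pd (n + 1)))) (hA0 : ∀ q : Pd n, (Fin.snoc q 0 : Pd (n + 1)) ∉ A)
    (hA1 : ∀ q : Pd n, (Fin.snoc q 1 : Pd (n + 1)) ∈ A ↔ q ∈ D) (hA2 : ∀ q : Pd n, (Fin.snoc q 2 : Pd (n + 1)) ∈ A) :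
    0 ≤ sStarD A B C := by
  have L := sum_sStarD_le_of_midTop A B C hA hB hC hA0 hA2
  have e : (univ.filter fun q : Pd n => (Fin.snoc q 1 : Pd (n + 1)) ∈ A) = D := by ext q; simp [hA1]
  rw [e] at L
  have h12 := hD _ _ (isUpperSet_filter_snoc hB 1) (isUpperSet_filter_snoc hC 2)
  have h21 := hD _ _ (isUpperSet_filter_snoc hB 2) (isUpperSet_filter_snoc hC 1)
  linarith

end Summit.CriticalPhenomena.PercolationContinuityZ3.Theorems.SahiGridPattern
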